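import Literature.Analysis.SpecialFunctions.RiemannThetaLevelThree
import Literature.Analysis.Complex.ThetaProductRigidity
import Mathlib.LinearAlgebra.Pi
import HarnessLib

/-!
# Lefschetz's theorem for the Riemann theta function: the level-three theta functions separate points and tangent vectors

Analytic form, on `ℂ^g`, of **Lefschetz's embedding theorem** for the principally polarised complex
torus `ℂ^g/(ℤ^g + Ωℤ^g)` in Siegel normal form (`Ω` symmetric, `Im Ω` positive definite):
the `3^g` theta functions of level three `f_c(z) = e^{2πi ᵗc z} ϑ(3z + Ωc, 3Ω)`
(`RiemannThetaLevelThree.lean`) — entire, `ℤ^g`-periodic, with the common factor of automorphy of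
`L³` along `Ωℤ^g` — have

* **no common zero** (`(bpf)`),
* **separate points modulo the lattice**: if `f_c(z₂) = γ f_c(z₁)` for all `c` then
  `z₂ - z₁ ∈ ℤ^g + Ωℤ^g` (`(inj)`),
* **separate tangent vectors**: if `∂_v f_c(z) = μ f_c(z)` for all `c` then `v = 0` (`(imm)`).

This is exactly the statement that `z ↦ [f_c(z)]_c` descends to an injective holomorphic immersion
of the torus into `ℙ^{3^g - 1}(ℂ)` (Mumford, *Tata Lectures on Theta I*, Ch. II §1, Thm. 1.3;
Griffiths–Harris, *Principles*, Ch. 2 §6 "The Lefschetz theorem"; Lange–Birkenhake Thm. 4.5.1;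
Mumford, *Abelian Varieties*, §3). The proof is the classical one (Griffiths–Harris loc. cit.):
by the cubic product formula every `ϑ(z+a)ϑ(z+b)ϑ(z-a-b)` is a combination of the `f_c`, so the
hypotheses of `(bpf)`, `(inj)`, `(imm)` transfer to all these products; `(bpf)` then contradicts
`ϑ ≢ 0` (entire functions form an integral domain); for `(inj)` the rigidity theorem
`ThetaRigidity.exists_exp_linear_of_cubic_translate` gives `ϑ(x + w) = C e^{ℓ(x)} ϑ(x)`,
`w = z₂ - z₁`, and comparing with the (quasi-)periodicity of `ϑ` forces `e^{ℓ(a)} = 1` on `ℤ^g` and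
`e^{ℓ(Ωb) + 2πi ᵗb w} = 1` on `ℤ^g`, i.e. `w ∈ ℤ^g + Ωℤ^g` (`riemannTheta_lattice_of_exp_linear`);
for `(imm)` `ThetaRigidity.exists_affine_of_cubic_leibniz` gives `∂_v ϑ = (c₀ + ℓ)ϑ`, periodicity
forces `ℓ = 0` and differentiating the quasi-periodicity forces `ᵗb v = 0` for all `b ∈ ℤ^g`
(`riemannTheta_eq_zero_of_fderiv_eq_affine_mul`).

Main statement: `exists_lefschetz_levelThree_family`. Everything is proved; no definitions, no
named facts.

## References

* [MumfordTata1] D. Mumford, Tata Lectures on Theta I (1983), Ch. II §1 (Thm. 1.3, pp. 124–128).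
* [GriffithsHarris1978] P. Griffiths, J. Harris, Principles of Algebraic Geometry (1978), Ch. 2 §6.
* [MumfordAV1970] D. Mumford, Abelian Varieties (1970), §3 (Theorem of Lefschetz).
* [LangeBirkenhake1992] H. Lange, Ch. Birkenhake, Complex Abelian Varieties (1992), Thm. 4.5.1.
-/

noncomputable section

open Complex Real Finset Filter Topology Matrix
open Literature.Analysis.Complex

namespace Literature.Analysis.SpecialFunctions

variable {g : ℕ}

/-! ### Linear forms on `ℂ^g` and the standard basis -/

/-- A `ℂ`-linear form on `ℂ^g` is determined by its values on the standard basis: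
`ℓ(x) = Σₖ xₖ ℓ(eₖ)`. [folklore] -/
theorem clm_apply_eq_sum (ℓ : (Fin g → ℂ) →L[ℂ] ℂ) (x : Fin g → ℂ) :
    ℓ x = ∑ k, x k * ℓ (fun j => if k = j then 1 else 0) := by
  have h := LinearMap.pi_apply_eq_sum_univ (ℓ : (Fin g → ℂ) →ₗ[ℂ] ℂ) x
  simpa [smul_eq_mul] using h

/-- `Σⱼ Ωᵢⱼ [k = j] = Ωᵢₖ`. [folklore] -/
theorem sum_mul_ite_eq (Ω : Matrix (Fin g) (Fin g) ℂ) (i k : Fin g) :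
    ∑ j, Ω i j * ((if k = j then (1 : ℤ) else 0 : ℤ) : ℂ) = Ω i k := by
  simp [Int.cast_ite]

/-! ### Lattice rigidity: `ϑ(x + w) = C e^{ℓ(x)} ϑ(x)` forces `w ∈ ℤ^g + Ωℤ^g` -/

/-- **A translate of `ϑ` which is `e^{linear} · ϑ` is a translate by a lattice vector.** For symmetric
`Ω` with `Im Ω ≥ c > 0`: if `ϑ(x + w) = C e^{ℓ(x)} ϑ(x)` for all `x` with `C ≠ 0` and `ℓ` linear, then
`w = m + Ωn` with `m, n ∈ ℤ^g` (periodicity in `ℤ^g` gives `e^{ℓ(a)} = 1`, quasi-periodicity in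
`Ωℤ^g` gives `e^{ℓ(Ωb) + 2πi ᵗb w} = 1`). [cite: GriffithsHarris1978, Ch. 2 §6 (proof of the Lefschetz theorem)]
[cite: MumfordAV1970, §3 (Theorem of Lefschetz, Step III)] -/
theorem riemannTheta_lattice_of_exp_linear (Ω : Matrix (Fin g) (Fin g) ℂ)
    (hΩ : ∀ i j, Ω i j = Ω j i) {c : ℝ} (hc : 0 < c)
    (hY : ∀ x : Fin g → ℝ, c * ∑ i, x i ^ 2 ≤ ∑ i, ∑ j, x i * (Ω i j).im * x j)
    {w : Fin g → ℂ} {C : ℂ} (hC : C ≠ 0) (ℓ : (Fin g → ℂ) →L[ℂ] ℂ)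
    (h : ∀ x, riemannTheta Ω (x + w) = C * cexp (ℓ x) * riemannTheta Ω x) :
    ∃ m n : Fin g → ℤ, ∀ i, w i = (m i : ℂ) + ∑ j, Ω i j * (n j : ℂ) := by
  obtain ⟨x₀, hx₀⟩ := exists_riemannTheta_ne_zero Ω hc hY
  -- Step A: `exp(ℓ(a)) = 1` for `a ∈ ℤ^g`
  have hA : ∀ a : Fin g → ℤ, cexp (ℓ fun i => (a i : ℂ)) = 1 := by
    intro a
    have h1 := h (fun i => x₀ i + a i)
    have per1 : riemannTheta Ω (fun i => x₀ i + a i) = riemannTheta Ω x₀ :=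
      riemannTheta_add_intCast Ω x₀ a
    have per2 : riemannTheta Ω ((fun i => x₀ i + (a i : ℂ)) + w) = riemannTheta Ω (x₀ + w) := by
      have e : ((fun i => x₀ i + (a i : ℂ)) + w) = fun i => (x₀ + w) i + a i := by
        funext i
        simp only [Pi.add_apply]
        ring
      rw [e, riemannTheta_add_intCast]
    have hℓ : ℓ (fun i => x₀ i + (a i : ℂ)) = ℓ x₀ + ℓ (fun i => (a i : ℂ)) := by
      rw [← map_add]
      rfl
    rw [per1, per2, h x₀, hℓ, Complex.exp_add] at h1
    have hne : C * cexp (ℓ x₀) * riemannTheta Ω x₀ ≠ 0 :=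
      mul_ne_zero (mul_ne_zero hC (Complex.exp_ne_zero _)) hx₀
    have h2 : C * cexp (ℓ x₀) * riemannTheta Ω x₀ * (cexp (ℓ fun i => (a i : ℂ)) - 1) = 0 := by
      linear_combination -h1
    rcases mul_eq_zero.mp h2 with h0 | h0
    · exact absurd h0 hne
    · exact sub_eq_zero.mp h0
  -- Step B: `ℓ(eₖ) = 2πi nₖ`
  have hB : ∀ k : Fin g, ∃ nk : ℤ, ℓ (fun j => if k = j then 1 else 0) = nk * (2 * π * I) := by
    intro k
    refine Complex.exp_eq_one_iff.mp ?_
    have := hA fun j => if k = j then 1 else 0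
    simpa [Int.cast_ite] using this
  choose n hn using hB
  -- Step C: `exp(ℓ(Ωb) + 2πi ᵗb w) = 1` for `b ∈ ℤ^g`
  have hC' : ∀ b : Fin g → ℤ,
      cexp (ℓ (fun i => ∑ j, Ω i j * (b j : ℂ)) + 2 * π * I * ∑ i, (b i : ℂ) * w i) = 1 := by
    intro b
    have h3 := h (fun i => x₀ i + ∑ j, Ω i j * (b j : ℂ))
    have q1 := riemannTheta_add_mulVec Ω hΩ x₀ b
    have q2 : riemannTheta Ω ((fun i => x₀ i + ∑ j, Ω i j * (b j : ℂ)) + w) =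
        cexp (-(π * I * ∑ i, ∑ j, (b i : ℂ) * Ω i j * (b j : ℂ)) -
          2 * π * I * ∑ i, (b i : ℂ) * (x₀ + w) i) * riemannTheta Ω (x₀ + w) := by
      have e : ((fun i => x₀ i + ∑ j, Ω i j * (b j : ℂ)) + w) =
          fun i => (x₀ + w) i + ∑ j, Ω i j * (b j : ℂ) := by
        funext i
        simp only [Pi.add_apply]
        ring
      rw [e, riemannTheta_add_mulVec Ω hΩ (x₀ + w) b]
    have hℓ : ℓ (fun i => x₀ i + ∑ j, Ω i j * (b j : ℂ)) =
        ℓ x₀ + ℓ (fun i => ∑ j, Ω i j * (b j : ℂ)) := by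
      rw [← map_add]
      rfl
    have hE : cexp (-(π * I * ∑ i, ∑ j, (b i : ℂ) * Ω i j * (b j : ℂ)) -
          2 * π * I * ∑ i, (b i : ℂ) * (x₀ + w) i) =
        cexp (-(π * I * ∑ i, ∑ j, (b i : ℂ) * Ω i j * (b j : ℂ)) -
          2 * π * I * ∑ i, (b i : ℂ) * x₀ i) * cexp (-(2 * π * I * ∑ i, (b i : ℂ) * w i)) := by
      rw [← Complex.exp_add]
      congr 1
      simp only [Pi.add_apply, mul_add, Finset.sum_add_distrib]
      ring
    rw [q1, q2, h x₀, hℓ, hE, Complex.exp_add] at h3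
    -- h3 : E₀ e^{-2πi bw} (C e^{ℓx₀} ϑx₀) = C (e^{ℓx₀} e^{ℓΩb}) (E₀ ϑx₀)
    set E₀ := cexp (-(π * I * ∑ i, ∑ j, (b i : ℂ) * Ω i j * (b j : ℂ)) -
      2 * π * I * ∑ i, (b i : ℂ) * x₀ i) with hE₀
    have hne : C * cexp (ℓ x₀) * riemannTheta Ω x₀ * E₀ ≠ 0 :=
      mul_ne_zero (mul_ne_zero (mul_ne_zero hC (Complex.exp_ne_zero _)) hx₀) (Complex.exp_ne_zero _)
    have h4 : C * cexp (ℓ x₀) * riemannTheta Ω x₀ * E₀ *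
        (cexp (ℓ fun i => ∑ j, Ω i j * (b j : ℂ)) - cexp (-(2 * π * I * ∑ i, (b i : ℂ) * w i))) = 0 := by
      linear_combination -h3
    rcases mul_eq_zero.mp h4 with h0 | h0
    · exact absurd h0 hne
    · rw [sub_eq_zero] at h0
      rw [Complex.exp_add, h0, ← Complex.exp_add, neg_add_cancel, Complex.exp_zero]
  -- Step D: read off the coordinates
  have hD : ∀ k : Fin g, ∃ mk : ℤ, w k = mk - ∑ l, Ω k l * (n l : ℂ) := by
    intro k
    obtain ⟨mk, hmk⟩ := Complex.exp_eq_one_iff.mp (hC' fun j => if k = j then 1 else 0)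
    refine ⟨mk, ?_⟩
    have e1 : (fun i => ∑ j, Ω i j * (((if k = j then (1 : ℤ) else 0 : ℤ) : ℂ))) = fun i => Ω i k := by
      funext i
      exact sum_mul_ite_eq Ω i k
    have e2 : ∑ i, (((if k = i then (1 : ℤ) else 0 : ℤ) : ℂ)) * w i = w k := by
      simp [Int.cast_ite]
    rw [e1, e2, clm_apply_eq_sum ℓ] at hmk
    simp_rw [hn] at hmk
    -- hmk : Σ_l Ω l k (n_l 2πi) + 2πi w_k = mk 2πi
    have h2pi : (2 * π * I : ℂ) ≠ 0 := by
      have hπ : (π : ℂ) ≠ 0 := Complex.ofReal_ne_zero.mpr Real.pi_ne_zero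
      exact mul_ne_zero (mul_ne_zero two_ne_zero hπ) Complex.I_ne_zero
    have hsym : ∑ l, Ω l k * (n l * (2 * π * I)) = (2 * π * I) * ∑ l, Ω k l * (n l : ℂ) := by
      rw [Finset.mul_sum]
      exact Finset.sum_congr rfl fun l _ => by rw [hΩ l k]; ring
    rw [hsym] at hmk
    apply mul_left_cancel₀ h2pi
    linear_combination hmk
  choose m hm using hD
  refine ⟨m, fun l => -n l, fun i => ?_⟩
  rw [hm i]
  simp only [Int.cast_neg, mul_neg, Finset.sum_neg_distrib]
  ring

/-! ### Tangent rigidity: `∂_v ϑ = (c₀ + ℓ) ϑ` forces `v = 0` -/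

/-- The linear form `x ↦ Σᵢ bᵢ xᵢ` on `ℂ^g` as a continuous linear map, and the derivative of the
quasi-periodicity factor `x ↦ exp(K - 2πi ᵗb x)`. [folklore] -/
theorem hasFDerivAt_cexp_const_sub_sum (K : ℂ) (b : Fin g → ℤ) (x : Fin g → ℂ) :
    HasFDerivAt (fun y : Fin g → ℂ => cexp (K - 2 * π * I * ∑ i, (b i : ℂ) * y i))
      (cexp (K - 2 * π * I * ∑ i, (b i : ℂ) * x i) •
        -((2 * π * I) • ∑ i, (b i : ℂ) • ContinuousLinearMap.proj (R := ℂ) (φ := fun _ : Fin g => ℂ) i))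
      x := by
  have h1 : HasFDerivAt (fun y : Fin g → ℂ => ∑ i, (b i : ℂ) * y i)
      (∑ i, (b i : ℂ) • ContinuousLinearMap.proj (R := ℂ) (φ := fun _ : Fin g => ℂ) i) x := by
    have := HasFDerivAt.fun_sum (u := Finset.univ)
      (A := fun i (y : Fin g → ℂ) => (b i : ℂ) * y i)
      (A' := fun i => (b i : ℂ) • ContinuousLinearMap.proj (R := ℂ) (φ := fun _ : Fin g => ℂ) i)
      (x := x) fun i _ => ((ContinuousLinearMap.proj (R := ℂ) (φ := fun _ : Fin g => ℂ) i
        ).hasFDerivAt.const_mul (b i : ℂ))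
    convert this using 1
  exact ((h1.const_mul (2 * π * I)).const_sub K).cexp

/-- **Differentiating the quasi-periodicity of `ϑ`**: for symmetric `Ω`, `b ∈ ℤ^g` and any `x, v`,
`∂_v ϑ(x + Ωb) = E_b(x) (∂_v ϑ(x) - 2πi ᵗb v · ϑ(x))`, `E_b(x) = exp(-πi ᵗbΩb - 2πi ᵗb x)`.
[cite: MumfordTata1, Ch. II §1] -/
theorem fderiv_riemannTheta_add_mulVec (Ω : Matrix (Fin g) (Fin g) ℂ) (hΩ : ∀ i j, Ω i j = Ω j i)
    {c : ℝ} (hc : 0 < c)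
    (hY : ∀ x : Fin g → ℝ, c * ∑ i, x i ^ 2 ≤ ∑ i, ∑ j, x i * (Ω i j).im * x j)
    (b : Fin g → ℤ) (x v : Fin g → ℂ) :
    fderiv ℂ (riemannTheta Ω) (x + fun i => ∑ j, Ω i j * (b j : ℂ)) v =
      cexp (-(π * I * ∑ i, ∑ j, (b i : ℂ) * Ω i j * (b j : ℂ)) - 2 * π * I * ∑ i, (b i : ℂ) * x i) *
        (fderiv ℂ (riemannTheta Ω) x v - 2 * π * I * (∑ i, (b i : ℂ) * v i) * riemannTheta Ω x) := by
  have hd := differentiable_riemannTheta Ω hc hY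
  -- the two descriptions of `y ↦ ϑ(y + Ωb)`
  have hfun : (fun y => riemannTheta Ω (y + fun i => ∑ j, Ω i j * (b j : ℂ))) = fun y =>
      cexp (-(π * I * ∑ i, ∑ j, (b i : ℂ) * Ω i j * (b j : ℂ)) - 2 * π * I * ∑ i, (b i : ℂ) * y i) *
        riemannTheta Ω y := by
    funext y
    exact riemannTheta_add_mulVec Ω hΩ y b
  have hL : HasFDerivAt (fun y => riemannTheta Ω (y + fun i => ∑ j, Ω i j * (b j : ℂ)))
      (fderiv ℂ (riemannTheta Ω) (x + fun i => ∑ j, Ω i j * (b j : ℂ))) x :=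
    (hasFDerivAt_comp_add_right (f := riemannTheta Ω) _).mpr (hd _).hasFDerivAt
  have hR := (hasFDerivAt_cexp_const_sub_sum
    (-(π * I * ∑ i, ∑ j, (b i : ℂ) * Ω i j * (b j : ℂ))) b x).mul (hd x).hasFDerivAt
  rw [hfun] at hL
  have heq := hL.unique hR
  rw [heq]
  simp only [_root_.add_apply, FunLike.coe_smul, Pi.smul_apply, _root_.neg_apply, FunLike.coe_sum,
    Finset.sum_apply, ContinuousLinearMap.proj_apply, smul_eq_mul]
  ring

/-- **`∂_v ϑ = (c₀ + ℓ) ϑ` forces `v = 0`** (symmetric `Ω`, `Im Ω ≥ c > 0`): periodicity of `∂_v ϑ`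
in `ℤ^g` gives `ℓ = 0`, and differentiating the quasi-periodicity in `Ωeₖ` gives `vₖ = 0`.
[cite: GriffithsHarris1978, Ch. 2 §6 (proof of the Lefschetz theorem)] [cite: MumfordAV1970, §3 (Theorem of Lefschetz, Step IV)] -/
theorem riemannTheta_eq_zero_of_fderiv_eq_affine_mul (Ω : Matrix (Fin g) (Fin g) ℂ)
    (hΩ : ∀ i j, Ω i j = Ω j i) {c : ℝ} (hc : 0 < c)
    (hY : ∀ x : Fin g → ℝ, c * ∑ i, x i ^ 2 ≤ ∑ i, ∑ j, x i * (Ω i j).im * x j)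
    {v : Fin g → ℂ} {c₀ : ℂ} (ℓ : (Fin g → ℂ) →L[ℂ] ℂ)
    (h : ∀ x, fderiv ℂ (riemannTheta Ω) x v = (c₀ + ℓ x) * riemannTheta Ω x) : v = 0 := by
  obtain ⟨x₀, hx₀⟩ := exists_riemannTheta_ne_zero Ω hc hY
  -- Step A: `ℓ(a) = 0` for `a ∈ ℤ^g`, hence `ℓ = 0`
  have hper : ∀ (a : Fin g → ℤ) (x : Fin g → ℂ),
      fderiv ℂ (riemannTheta Ω) (x + fun i => (a i : ℂ)) = fderiv ℂ (riemannTheta Ω) x := by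
    intro a x
    have hfun : (fun y => riemannTheta Ω (y + fun i => (a i : ℂ))) = riemannTheta Ω :=
      funext fun y => riemannTheta_add_intCast Ω y a
    rw [← fderiv_comp_add_right (f := riemannTheta Ω) (fun i => (a i : ℂ)), hfun]
  have hA : ∀ a : Fin g → ℤ, ℓ (fun i => (a i : ℂ)) = 0 := by
    intro a
    have h1 := h (x₀ + fun i => (a i : ℂ))
    rw [hper a x₀, h x₀, map_add] at h1
    have per : riemannTheta Ω (x₀ + fun i => (a i : ℂ)) = riemannTheta Ω x₀ :=
      riemannTheta_add_intCast Ω x₀ a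
    rw [per] at h1
    have h2 : ℓ (fun i => (a i : ℂ)) * riemannTheta Ω x₀ = 0 := by linear_combination -h1
    exact (mul_eq_zero.mp h2).resolve_right hx₀
  have hℓ : ∀ y, ℓ y = 0 := by
    intro y
    rw [clm_apply_eq_sum ℓ y]
    refine Finset.sum_eq_zero fun k _ => ?_
    have := hA fun j => if k = j then 1 else 0
    simp only [Int.cast_ite, Int.cast_one, Int.cast_zero] at this
    rw [this, mul_zero]
  have hD : ∀ x, fderiv ℂ (riemannTheta Ω) x v = c₀ * riemannTheta Ω x := fun x => by
    rw [h x, hℓ x, add_zero]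
  -- Step B: differentiate the quasi-periodicity along `v` at `x₀` with `b = eₖ`
  funext k
  have key := fderiv_riemannTheta_add_mulVec Ω hΩ hc hY (fun j => if k = j then 1 else 0) x₀ v
  rw [hD, hD, show (x₀ + fun i => ∑ j, Ω i j * (((if k = j then (1 : ℤ) else 0 : ℤ) : ℂ))) =
      fun i => x₀ i + ∑ j, Ω i j * (((if k = j then (1 : ℤ) else 0 : ℤ) : ℂ)) from rfl,
    riemannTheta_add_mulVec Ω hΩ x₀] at key
  set E₀ := cexp (-(π * I * ∑ i, ∑ j, (((if k = i then (1 : ℤ) else 0 : ℤ) : ℂ)) * Ω i j *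
      (((if k = j then (1 : ℤ) else 0 : ℤ) : ℂ))) -
    2 * π * I * ∑ i, (((if k = i then (1 : ℤ) else 0 : ℤ) : ℂ)) * x₀ i) with hE₀
  have hsum : ∑ i, (((if k = i then (1 : ℤ) else 0 : ℤ) : ℂ)) * v i = v k := by
    simp [Int.cast_ite]
  rw [hsum] at key
  have h2pi : (2 * π * I : ℂ) ≠ 0 := by
    have hπ : (π : ℂ) ≠ 0 := Complex.ofReal_ne_zero.mpr Real.pi_ne_zero
    exact mul_ne_zero (mul_ne_zero two_ne_zero hπ) Complex.I_ne_zero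
  have hne : E₀ * (2 * π * I) * riemannTheta Ω x₀ ≠ 0 :=
    mul_ne_zero (mul_ne_zero (Complex.exp_ne_zero _) h2pi) hx₀
  have h3 : E₀ * (2 * π * I) * riemannTheta Ω x₀ * v k = 0 := by linear_combination key
  simpa using (mul_eq_zero.mp h3).resolve_left hne

/-! ### From the cubic identities to lattice / tangent rigidity -/

/-- **Injectivity step of Lefschetz's theorem for `ϑ`**: if
`ϑ(z₂+a)ϑ(z₂+b)ϑ(z₂-a-b) = γ ϑ(z₁+a)ϑ(z₁+b)ϑ(z₁-a-b)` for all `a, b ∈ ℂ^g`, then `z₂ - z₁ ∈ ℤ^g + Ωℤ^g`.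
[cite: GriffithsHarris1978, Ch. 2 §6 (proof of the Lefschetz theorem)] [cite: MumfordAV1970, §3 (Theorem of Lefschetz, Step III)] -/
theorem riemannTheta_lattice_of_cubic_translate (Ω : Matrix (Fin g) (Fin g) ℂ)
    (hΩ : ∀ i j, Ω i j = Ω j i) {c : ℝ} (hc : 0 < c)
    (hY : ∀ x : Fin g → ℝ, c * ∑ i, x i ^ 2 ≤ ∑ i, ∑ j, x i * (Ω i j).im * x j)
    {z₁ z₂ : Fin g → ℂ} {γ : ℂ}
    (h : ∀ a b, riemannTheta Ω (z₂ + a) * riemannTheta Ω (z₂ + b) * riemannTheta Ω (z₂ - a - b) =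
      γ * (riemannTheta Ω (z₁ + a) * riemannTheta Ω (z₁ + b) * riemannTheta Ω (z₁ - a - b))) :
    ∃ m n : Fin g → ℤ, ∀ i, z₂ i - z₁ i = (m i : ℂ) + ∑ j, Ω i j * (n j : ℂ) := by
  have hd := differentiable_riemannTheta Ω hc hY
  have h0 := riemannTheta_ne_zero Ω hc hY
  obtain ⟨C, ℓ, hC, hCℓ⟩ := ThetaRigidity.exists_exp_linear_of_cubic_translate hd h0 h
  obtain ⟨m, n, hmn⟩ := riemannTheta_lattice_of_exp_linear Ω hΩ hc hY hC ℓ hCℓ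
  exact ⟨m, n, fun i => by simpa using hmn i⟩

/-- `x ↦ ∂_v ϑ(x)` is entire. [folklore] -/
theorem differentiable_fderiv_riemannTheta_apply (Ω : Matrix (Fin g) (Fin g) ℂ) {c : ℝ}
    (hc : 0 < c) (hY : ∀ x : Fin g → ℝ, c * ∑ i, x i ^ 2 ≤ ∑ i, ∑ j, x i * (Ω i j).im * x j)
    (v : Fin g → ℂ) : Differentiable ℂ fun x => fderiv ℂ (riemannTheta Ω) x v := by
  have hd := differentiable_riemannTheta Ω hc hY
  have han := (ThetaRigidity.analyticOnNhd_univ hd).fderiv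
  have hdd : Differentiable ℂ (fderiv ℂ (riemannTheta Ω)) := fun x =>
    (han x (Set.mem_univ x)).differentiableAt
  exact (ContinuousLinearMap.apply ℂ ℂ v).differentiable.comp hdd

/-- **Immersion step of Lefschetz's theorem for `ϑ`**: if, with `D = ∂_v ϑ`,
`D(z+a)ϑ(z+b)ϑ(z-a-b) + ϑ(z+a)D(z+b)ϑ(z-a-b) + ϑ(z+a)ϑ(z+b)D(z-a-b) = μ ϑ(z+a)ϑ(z+b)ϑ(z-a-b)` for all
`a, b ∈ ℂ^g`, then `v = 0`. [cite: GriffithsHarris1978, Ch. 2 §6 (proof of the Lefschetz theorem)]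
[cite: MumfordAV1970, §3 (Theorem of Lefschetz, Step IV)] -/
theorem riemannTheta_tangent_of_cubic_leibniz (Ω : Matrix (Fin g) (Fin g) ℂ)
    (hΩ : ∀ i j, Ω i j = Ω j i) {c : ℝ} (hc : 0 < c)
    (hY : ∀ x : Fin g → ℝ, c * ∑ i, x i ^ 2 ≤ ∑ i, ∑ j, x i * (Ω i j).im * x j)
    {z v : Fin g → ℂ} {μ : ℂ}
    (h : ∀ a b,
      fderiv ℂ (riemannTheta Ω) (z + a) v * riemannTheta Ω (z + b) * riemannTheta Ω (z - a - b) +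
        riemannTheta Ω (z + a) * fderiv ℂ (riemannTheta Ω) (z + b) v * riemannTheta Ω (z - a - b) +
        riemannTheta Ω (z + a) * riemannTheta Ω (z + b) * fderiv ℂ (riemannTheta Ω) (z - a - b) v =
      μ * (riemannTheta Ω (z + a) * riemannTheta Ω (z + b) * riemannTheta Ω (z - a - b))) :
    v = 0 := by
  have hd := differentiable_riemannTheta Ω hc hY
  have h0 := riemannTheta_ne_zero Ω hc hY
  have hD := differentiable_fderiv_riemannTheta_apply Ω hc hY v
  obtain ⟨c₀, ℓ, hcl⟩ := ThetaRigidity.exists_affine_of_cubic_leibniz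
    (D := fun x => fderiv ℂ (riemannTheta Ω) x v) hd hD h0 h
  exact riemannTheta_eq_zero_of_fderiv_eq_affine_mul Ω hΩ hc hY ℓ hcl

/-! ### Families through which all `ϑ(z+a)ϑ(z+b)ϑ(z-a-b)` factor -/

/-- **No common zeros.** If every product `ϑ(z+a)ϑ(z+b)ϑ(z-a-b)` is a combination of a family
`(f_c)`, the `f_c` have no common zero (a common zero `z` would make
`(a, b) ↦ ϑ(z+a)ϑ(z+b)ϑ(z-a-b)` vanish identically on `ℂ^g × ℂ^g`, contradicting `ϑ ≢ 0` in the
integral domain of entire functions). [cite: GriffithsHarris1978, Ch. 2 §6 (proof of the Lefschetz theorem)]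
[cite: MumfordAV1970, §3 (Theorem of Lefschetz, Step II)] -/
theorem exists_apply_ne_zero_of_cubic_span (Ω : Matrix (Fin g) (Fin g) ℂ) {c : ℝ} (hc : 0 < c)
    (hY : ∀ x : Fin g → ℝ, c * ∑ i, x i ^ 2 ≤ ∑ i, ∑ j, x i * (Ω i j).im * x j)
    {ι : Type*} [Fintype ι] (f : ι → (Fin g → ℂ) → ℂ)
    (hP : ∀ a b : Fin g → ℂ, ∃ Λ : ι → ℂ, ∀ z : Fin g → ℂ,
      riemannTheta Ω (z + a) * riemannTheta Ω (z + b) * riemannTheta Ω (z - a - b) =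
        ∑ k, Λ k * f k z)
    (z : Fin g → ℂ) : ∃ k, f k z ≠ 0 := by
  by_contra! hz
  have hd := differentiable_riemannTheta Ω hc hY
  obtain ⟨x₀, hx₀⟩ := exists_riemannTheta_ne_zero Ω hc hY
  have hvan : ∀ a b : Fin g → ℂ,
      riemannTheta Ω (z + a) * riemannTheta Ω (z + b) * riemannTheta Ω (z - a - b) = 0 := by
    intro a b
    obtain ⟨Λ, hΛ⟩ := hP a b
    rw [hΛ z]
    exact Finset.sum_eq_zero fun k _ => by rw [hz k, mul_zero]
  -- on `E × E ∋ (a, b)`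
  have hF : Differentiable ℂ fun p : (Fin g → ℂ) × (Fin g → ℂ) =>
      riemannTheta Ω (z + p.1) * riemannTheta Ω (z + p.2) :=
    (hd.comp (by fun_prop)).mul (hd.comp (by fun_prop))
  have hG : Differentiable ℂ fun p : (Fin g → ℂ) × (Fin g → ℂ) => riemannTheta Ω (z - p.1 - p.2) :=
    hd.comp (by fun_prop)
  have hFG := ThetaRigidity.eq_zero_of_mul_eq_zero hF hG (fun p => hvan p.1 p.2)
    (x₀ := (z - x₀, 0)) (by simpa using hx₀)
  have hF₁ : Differentiable ℂ fun p : (Fin g → ℂ) × (Fin g → ℂ) => riemannTheta Ω (z + p.1) :=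
    hd.comp (by fun_prop)
  have hF₂ : Differentiable ℂ fun p : (Fin g → ℂ) × (Fin g → ℂ) => riemannTheta Ω (z + p.2) :=
    hd.comp (by fun_prop)
  have h12 := ThetaRigidity.eq_zero_of_mul_eq_zero hF₁ hF₂ (fun p => congrFun hFG p)
    (x₀ := (0, x₀ - z)) (by simpa using hx₀)
  have := congrFun h12 (x₀ - z, 0)
  simp only [Pi.zero_apply, add_sub_cancel] at this
  exact hx₀ this

/-- **Separation of points modulo the lattice.** If every `ϑ(z+a)ϑ(z+b)ϑ(z-a-b)` is a combination of
the `f_c` and `f_c(z₂) = γ f_c(z₁)` for all `c`, then `z₂ - z₁ ∈ ℤ^g + Ωℤ^g`.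
[cite: GriffithsHarris1978, Ch. 2 §6 (proof of the Lefschetz theorem)] [cite: MumfordTata1, Ch. II §1 Thm. 1.3] -/
theorem lattice_of_proportional_of_cubic_span (Ω : Matrix (Fin g) (Fin g) ℂ)
    (hΩ : ∀ i j, Ω i j = Ω j i) {c : ℝ} (hc : 0 < c)
    (hY : ∀ x : Fin g → ℝ, c * ∑ i, x i ^ 2 ≤ ∑ i, ∑ j, x i * (Ω i j).im * x j)
    {ι : Type*} [Fintype ι] (f : ι → (Fin g → ℂ) → ℂ)
    (hP : ∀ a b : Fin g → ℂ, ∃ Λ : ι → ℂ, ∀ z : Fin g → ℂ,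
      riemannTheta Ω (z + a) * riemannTheta Ω (z + b) * riemannTheta Ω (z - a - b) =
        ∑ k, Λ k * f k z)
    {z₁ z₂ : Fin g → ℂ} {γ : ℂ} (hγ : ∀ k, f k z₂ = γ * f k z₁) :
    ∃ m n : Fin g → ℤ, ∀ i, z₂ i - z₁ i = (m i : ℂ) + ∑ j, Ω i j * (n j : ℂ) := by
  refine riemannTheta_lattice_of_cubic_translate Ω hΩ hc hY (γ := γ) fun a b => ?_
  obtain ⟨Λ, hΛ⟩ := hP a b
  rw [hΛ z₂, hΛ z₁, Finset.mul_sum]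
  exact Finset.sum_congr rfl fun k _ => by rw [hγ k]; ring

/-- The `v`-derivative of `z ↦ ϑ(z+a)ϑ(z+b)ϑ(z-a-b)` (Leibniz rule). [folklore] -/
theorem hasFDerivAt_riemannTheta_cubic (Ω : Matrix (Fin g) (Fin g) ℂ) {c : ℝ} (hc : 0 < c)
    (hY : ∀ x : Fin g → ℝ, c * ∑ i, x i ^ 2 ≤ ∑ i, ∑ j, x i * (Ω i j).im * x j)
    (a b z : Fin g → ℂ) :
    HasFDerivAt (fun y => riemannTheta Ω (y + a) * riemannTheta Ω (y + b) * riemannTheta Ω (y - a - b))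
      ((riemannTheta Ω (z + a) * riemannTheta Ω (z + b)) • fderiv ℂ (riemannTheta Ω) (z - a - b) +
        riemannTheta Ω (z - a - b) •
          (riemannTheta Ω (z + a) • fderiv ℂ (riemannTheta Ω) (z + b) +
            riemannTheta Ω (z + b) • fderiv ℂ (riemannTheta Ω) (z + a))) z := by
  have hd := differentiable_riemannTheta Ω hc hY
  have hA : HasFDerivAt (fun y => riemannTheta Ω (y + a)) (fderiv ℂ (riemannTheta Ω) (z + a)) z :=
    (hasFDerivAt_comp_add_right (f := riemannTheta Ω) a).mpr (hd _).hasFDerivAt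
  have hB : HasFDerivAt (fun y => riemannTheta Ω (y + b)) (fderiv ℂ (riemannTheta Ω) (z + b)) z :=
    (hasFDerivAt_comp_add_right (f := riemannTheta Ω) b).mpr (hd _).hasFDerivAt
  have hC : HasFDerivAt (fun y => riemannTheta Ω (y - a - b))
      (fderiv ℂ (riemannTheta Ω) (z - a - b)) z := by
    have e : (fun y => riemannTheta Ω (y - a - b)) = fun y => riemannTheta Ω (y + (-a - b)) := by
      funext y
      congr 1
      abel
    have e' : z - a - b = z + (-a - b) := by abel
    rw [e, e']
    exact (hasFDerivAt_comp_add_right (f := riemannTheta Ω) (-a - b)).mpr (hd _).hasFDerivAt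
  exact (hA.mul hB).mul hC

/-- **Separation of tangent vectors.** If every `ϑ(z+a)ϑ(z+b)ϑ(z-a-b)` is a combination of the
entire functions `f_c` and `∂_v f_c(z) = μ f_c(z)` for all `c`, then `v = 0`.
[cite: GriffithsHarris1978, Ch. 2 §6 (proof of the Lefschetz theorem)] [cite: MumfordTata1, Ch. II §1 Thm. 1.3] -/
theorem tangent_eq_zero_of_cubic_span (Ω : Matrix (Fin g) (Fin g) ℂ)
    (hΩ : ∀ i j, Ω i j = Ω j i) {c : ℝ} (hc : 0 < c)
    (hY : ∀ x : Fin g → ℝ, c * ∑ i, x i ^ 2 ≤ ∑ i, ∑ j, x i * (Ω i j).im * x j)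
    {ι : Type*} [Fintype ι] (f : ι → (Fin g → ℂ) → ℂ) (hf : ∀ k, Differentiable ℂ (f k))
    (hP : ∀ a b : Fin g → ℂ, ∃ Λ : ι → ℂ, ∀ z : Fin g → ℂ,
      riemannTheta Ω (z + a) * riemannTheta Ω (z + b) * riemannTheta Ω (z - a - b) =
        ∑ k, Λ k * f k z)
    {z v : Fin g → ℂ} {μ : ℂ} (hμ : ∀ k, fderiv ℂ (f k) z v = μ * f k z) : v = 0 := by
  refine riemannTheta_tangent_of_cubic_leibniz Ω hΩ hc hY (z := z) (μ := μ) fun a b => ?_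
  obtain ⟨Λ, hΛ⟩ := hP a b
  -- the two derivatives of `P(y) = ϑ(y+a)ϑ(y+b)ϑ(y-a-b) = Σ Λ_k f_k(y)` at `z`
  have h1 := hasFDerivAt_riemannTheta_cubic Ω hc hY a b z
  have h2 : HasFDerivAt (fun y => ∑ k, Λ k * f k y) (∑ k, Λ k • fderiv ℂ (f k) z) z :=
    HasFDerivAt.fun_sum (u := Finset.univ) (A := fun k y => Λ k * f k y)
      (A' := fun k => Λ k • fderiv ℂ (f k) z) (x := z)
      fun k _ => ((hf k z).hasFDerivAt.const_mul (Λ k))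
  have hfun : (fun y => riemannTheta Ω (y + a) * riemannTheta Ω (y + b) * riemannTheta Ω (y - a - b)) =
      fun y => ∑ k, Λ k * f k y := funext hΛ
  rw [hfun] at h1
  have heq := congrArg (fun L : (Fin g → ℂ) →L[ℂ] ℂ => L v) (h1.unique h2)
  simp only [_root_.add_apply, FunLike.coe_smul, Pi.smul_apply, smul_eq_mul, FunLike.coe_sum,
    Finset.sum_apply, hμ] at heq
  -- heq : (Leibniz expression) = Σ Λ_k μ f_k z
  have hsum : ∑ k, Λ k * (μ * f k z) = μ * ∑ k, Λ k * f k z := by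
    rw [Finset.mul_sum]
    exact Finset.sum_congr rfl fun k _ => by ring
  rw [hsum, ← hΛ z] at heq
  linear_combination heq

/-! ### Lefschetz's theorem, analytic form -/

/-- **Lefschetz's theorem for `ℂ^g/(ℤ^g + Ωℤ^g)`, analytic form.** For symmetric `Ω` with
`Im Ω ≥ c > 0` there is a finite family `(f_c)_{c ∈ {0,1,2}^g}` of entire functions on `ℂ^g` which
(i) are `ℤ^g`-periodic, (ii) satisfy the common quasi-periodicity
`f_c(z + Ωn) = exp(-3πi ᵗnΩn - 6πi ᵗn z) f_c(z)`, `n ∈ ℤ^g` (so that `z ↦ [f_c(z)]_c` is well defined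
on the torus), (iii) have no common zero, (iv) separate points modulo the lattice —
`f_c(z₂) = γ f_c(z₁)` for all `c` forces `z₂ - z₁ ∈ ℤ^g + Ωℤ^g` — and (v) separate tangent vectors —
`∂_v f_c(z) = μ f_c(z)` for all `c` forces `v = 0`. The family is the level-three theta family
`f_c(z) = e^{2πi ᵗc z} ϑ(3z + Ωc, 3Ω)`. [cite: MumfordTata1, Ch. II §1 Thm. 1.3]
[cite: GriffithsHarris1978, Ch. 2 §6 (The Lefschetz theorem)] [cite: LangeBirkenhake1992, Thm. 4.5.1]
[cite: MumfordAV1970, §3 (Theorem of Lefschetz)] -/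
theorem exists_lefschetz_levelThree_family (Ω : Matrix (Fin g) (Fin g) ℂ)
    (hΩ : ∀ i j, Ω i j = Ω j i) {c : ℝ} (hc : 0 < c)
    (hY : ∀ x : Fin g → ℝ, c * ∑ i, x i ^ 2 ≤ ∑ i, ∑ j, x i * (Ω i j).im * x j) :
    ∃ f : (Fin g → Fin 3) → (Fin g → ℂ) → ℂ,
      (∀ c₃, Differentiable ℂ (f c₃)) ∧
      (∀ c₃ (z : Fin g → ℂ) (n : Fin g → ℤ), f c₃ (fun i => z i + n i) = f c₃ z) ∧
      (∀ c₃ (z : Fin g → ℂ) (n : Fin g → ℤ),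
        f c₃ (fun i => z i + ∑ j, Ω i j * (n j : ℂ)) =
          cexp (3 * (-(π * I * ∑ i, ∑ j, (n i : ℂ) * Ω i j * (n j : ℂ)) -
            2 * π * I * ∑ i, (n i : ℂ) * z i)) * f c₃ z) ∧
      (∀ z : Fin g → ℂ, ∃ c₃, f c₃ z ≠ 0) ∧
      (∀ (z₁ z₂ : Fin g → ℂ) (γ : ℂ), (∀ c₃, f c₃ z₂ = γ * f c₃ z₁) →
        ∃ m n : Fin g → ℤ, ∀ i, z₂ i - z₁ i = (m i : ℂ) + ∑ j, Ω i j * (n j : ℂ)) ∧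
      (∀ (z v : Fin g → ℂ) (μ : ℂ), (∀ c₃, fderiv ℂ (f c₃) z v = μ * f c₃ z) → v = 0) := by
  obtain ⟨f, hdiff, hper, hqper, hP⟩ := exists_levelThree_family Ω hΩ hc hY
  exact ⟨f, hdiff, hper, hqper, exists_apply_ne_zero_of_cubic_span Ω hc hY f hP,
    fun z₁ z₂ γ hγ => lattice_of_proportional_of_cubic_span Ω hΩ hc hY f hP hγ,
    fun z v μ hμ => tangent_eq_zero_of_cubic_span Ω hΩ hc hY f hdiff hP hμ⟩

/-- **Lefschetz's theorem, analytic form, for `Ω` in the Siegel upper half space** (symmetric with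
positive definite imaginary part). [cite: MumfordTata1, Ch. II §1 Thm. 1.3]
[cite: GriffithsHarris1978, Ch. 2 §6 (The Lefschetz theorem)] -/
theorem exists_lefschetz_levelThree_family_of_posDef (Ω : Matrix (Fin g) (Fin g) ℂ)
    (hΩ : ∀ i j, Ω i j = Ω j i) (hpos : (Matrix.of fun i j => (Ω i j).im).PosDef) :
    ∃ f : (Fin g → Fin 3) → (Fin g → ℂ) → ℂ,
      (∀ c₃, Differentiable ℂ (f c₃)) ∧
      (∀ c₃ (z : Fin g → ℂ) (n : Fin g → ℤ), f c₃ (fun i => z i + n i) = f c₃ z) ∧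
      (∀ c₃ (z : Fin g → ℂ) (n : Fin g → ℤ),
        f c₃ (fun i => z i + ∑ j, Ω i j * (n j : ℂ)) =
          cexp (3 * (-(π * I * ∑ i, ∑ j, (n i : ℂ) * Ω i j * (n j : ℂ)) -
            2 * π * I * ∑ i, (n i : ℂ) * z i)) * f c₃ z) ∧
      (∀ z : Fin g → ℂ, ∃ c₃, f c₃ z ≠ 0) ∧
      (∀ (z₁ z₂ : Fin g → ℂ) (γ : ℂ), (∀ c₃, f c₃ z₂ = γ * f c₃ z₁) →
        ∃ m n : Fin g → ℤ, ∀ i, z₂ i - z₁ i = (m i : ℂ) + ∑ j, Ω i j * (n j : ℂ)) ∧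
      (∀ (z v : Fin g → ℂ) (μ : ℂ), (∀ c₃, fderiv ℂ (f c₃) z v = μ * f c₃ z) → v = 0) := by
  obtain ⟨c, hc, hY⟩ := exists_pos_mul_sum_sq_le_of_posDef_im Ω hpos
  exact exists_lefschetz_levelThree_family Ω hΩ hc hY

end Literature.Analysis.SpecialFunctions

end
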